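import Summits.QuantumFields.BalabanUV.Beta.GAN24.GaugeReadLabelSums
import Summits.QuantumFields.BalabanUV.Beta.GAN24.KernelLegCharges
import Summits.QuantumFields.BalabanUV.Beta.GAN24.LatticeFreeze
import Summits.QuantumFields.BalabanUV.Beta.GAN24.TaylorRowLamTopTable

/-!
# `BalabanUV.Beta.GAN24.GaugeReadChargeDipole` — binder row G-an2-4 / (CONV-C), CT-W «WC-TL», (Q-R) «QR-LL», the OWNER gan24-p1's R11 ∕ g26 W9–W15 CHARGE AUDIT of
# the σ-letters, piece (γ) = the response (gauge-read) letter: **THE FIRST SLOT-MOMENT («SLOT-DIPOLE») OF THE (γ) CHARGE ABOUT THE LABEL, IN CLOSED FORM** — the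
# (γ) side of W15 «both closed forms wanted side by side» (the (α) side is road-P2's `WardResidualRotatedVertexDipole`); the (S) identity of record will read
# «(α)-dipole + (γ)-dipole (+ (4.8)(d)) = 0» — NOT proved here (G-an2-4 formalisation swarm, unit `b2b-balaban-gan24-formalise-leaf-06`, gen 44; INTENT 4,
# sequel of `GaugeReadCharge` (INTENT 3), whose `hasSum_prod_gaugeSup` value at `A := A ν y′`, `g := gaugeWt N y` is the slot charge `Q(y′)` below).

NOT IN PRINT; OUR BOOKKEEPING ([folklore] block geometry of the gauge weight (an1's `AxialDressing.l1_sub_le_of_blk_eq` BY NAME), gen-44 `GaugeReadLabelSums.abs_read_le_of_support`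
BY NAME, gen-8 `KernelLegCharges.summable_prod_of_biLoc`, p1's `LatticeFreeze.mul_exp_neg_le`, leaf-10's `TaylorRowLamTopTable.abs_apply_le_l1`, and one Fubini on `Site × Site`).  HONEST FRAMING (cell contract, verbatim):
«discharging `BetaPertH` makes Bałaban's UV stability UNCONDITIONAL — a real constructive-QFT result; it is NOT the continuum limit and NOT the Clay problem.»  HONEST DEPENDENCY
(verbatim): «continuum YM on T⁴ ⇐ BetaPertH ∧ nine spine estimates (0/9 proved); BetaPertH ⇐ (D1) ∧ (D4) ∧ CAP+tail; G-an2-4 gates asym, D1 and NE2/3/4.»  No cited fact, no `def`,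
no `def … : Prop`, 0 sorry.
* §1 `l1_sub_le_of_gaugeWt_ne_zero` (`gaugeWt N y κ x ≠ 0 → |N•y − x|₁ ≤ (d+1)N + 1`), `dist_le_of_gaugeWt_ne_zero` (the slot witness `N|y − y′|₁ − ((d+1)N+1) ≤ |x − N•y′|₁`).
* §2 **`abs_read_gaugeWt_le`** — READ WEIGHTS DECAY OFF THE LABEL: for `A′` bi-localised at `(p, N•y′)`, `|Σ'Σ A′ u x₂ a (inl κ₂)·gaugeWt N y κ₂ x₂| ≤ K₁·e^{−(δ/2)N|y − y′|₁}·e^{−δ|u − p|₁}`,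
  `K₁ = (d+1)·C·Zl(δ/2)·e^{(δ/2)((d+1)N+1)}` — so the (γ) charge of the slot `y′` is exponentially small in the label–slot distance (no value asserted).
* §3 `abs_tsum_prod_le_of_biLoc` (`|Z(K)| ≤ C·Zl(δ)²`); §4 `abs_coord_mul_exp_le` (`|(y′−y)_λ|·e^{−(δ/2)N|y−y′|₁} ≤ (4/δ)·e^{−(δ/4)|y′−y|₁}`),
  `summable_shifted_majorant`, **`summable_moment_fine ∕ summable_moment_coarse`** (the moment families are absolutely summable on (slot, stencil index)).
* §5 **`hasSum_slotMoment_gaugeCharge`** — `Σ'_{y′} (y′ − y)_λ·Q(y′) = Σ_κ Σ'_u (Σ'_{y′} (y′ − y)_λ·w_κ(y′,u))·Z(S κ u) + Σ_ρ Σ'_w (Σ'_{y′} (y′ − y)_λ·w′_ρ(y′,w))·Z(M ρ w)`: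
  the letters' pair charges weighted by the FIRST SLOT-MOMENTS OF THE READ WEIGHTS.
Asserts NO value of any stencil charge, NO cancellation against (α), NO estimate uniform in the level; decides nothing about (LT) ∕ K-LL-3 ∕ K-CHG-1; NEVER «G-an2-4 closed»
as (CONV-C); NOT D1, NOT BetaPertH, NOT continuum, NOT Clay.  2026-08-22; no existing file touched.
-/

noncomputable section

open Finset
open scoped BigOperators
open Literature.MathematicalPhysics.QuantumFieldTheory
open Literature.MathematicalPhysics.QuantumFieldTheory.Balaban1983to89
open Literature.MathematicalPhysics.QuantumFieldTheory.Balaban1983to89.Beta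
open B12Sec2to5 (l1 l1_nonneg)
open B6BondElimination (unitVec unitVec_apply)
open ExpKernelCalculus (Site MKer BiLoc VertexFamily Zl Zl_nonneg Zl_pos summable_exp_shift' tsum_exp_shift' l1_sub_triangle l1_sub_symm l1_natSmul)
open AveragingContours (blk)
open AxialProjector (blk_zsmul)
open AxialDressing (l1_sub_le_of_blk_eq)
open OneStepResolventKernel (Fib LocStencil)
open Summit.QuantumFields.BalabanUV.Beta.KernelWardRelative (gaugeWt)
open Summit.QuantumFields.BalabanUV.Beta.KernelWardResidual (abs_gaugeWt_le_one)
open Summit.QuantumFields.BalabanUV.Beta.GAN24.KernelLegCharges (summable_prod_of_biLoc)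
open Summit.QuantumFields.BalabanUV.Beta.GAN24.LatticeFreeze (mul_exp_neg_le)
open Summit.QuantumFields.BalabanUV.Beta.GAN24.TaylorRowLamTopTable (abs_apply_le_l1)
open Summit.QuantumFields.BalabanUV.Beta.GAN24.GaugeReadLabelSums (abs_read_le_of_support)

namespace Summit.QuantumFields.BalabanUV.Beta.GAN24.GaugeReadChargeDipole

variable {d : ℕ}

/-! ## §1 Geometry: the gauge weight of the label `y` lives within `(d+1)·N + 1` of `N•y` -/

/-- [folklore] `gaugeWt N y κ x ≠ 0 → |N•y − x|₁ ≤ (d+1)·N + 1` (`1 ≤ N`): the weight is the difference of the block indicator at `x + e_κ` and at `x`,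
so one of the two points lies in the block `B(y)`. -/
theorem l1_sub_le_of_gaugeWt_ne_zero {N : ℕ} (hN : 1 ≤ N) {y x : Site (d + 1)} {κ : Fin (d + 1)} (h : gaugeWt N y κ x ≠ 0) :
    l1 (((N : ℤ) • y) - x) ≤ ((d : ℝ) + 1) * N + 1 := by
  have hy : blk N ((N : ℤ) • y) = y := blk_zsmul hN y
  by_cases h1 : blk N x = y
  · have h3 := l1_sub_le_of_blk_eq hN (x := (N : ℤ) • y) (z := x) (by rw [h1, hy])
    linarith
  · by_cases h2 : blk N (x + unitVec κ) = y
    · have h3 := l1_sub_le_of_blk_eq hN (x := (N : ℤ) • y) (z := x + unitVec κ) (by rw [h2, hy])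
      have h4 : l1 ((N : ℤ) • y - x) ≤ l1 ((N : ℤ) • y - (x + unitVec κ)) + l1 ((x + unitVec κ) - x) := l1_sub_triangle _ _ _
      have h5 : l1 ((x + unitVec κ) - x) = 1 := by
        rw [add_sub_cancel_left]
        unfold l1
        rw [Finset.sum_eq_single κ (fun i _ hi => by simp [unitVec_apply, hi]) (fun hκ => absurd (Finset.mem_univ κ) hκ)]
        simp [unitVec_apply]
      linarith
    · exact absurd (by simp only [gaugeWt, if_neg h1, if_neg h2, sub_zero]) h

/-- [folklore] The slot witness for `GaugeReadLabelSums.abs_read_le_of_support`: on the support of `gaugeWt N y`, `N·|y − y′|₁ − ((d+1)·N + 1) ≤ |x − N•y′|₁`. -/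
theorem dist_le_of_gaugeWt_ne_zero {N : ℕ} (hN : 1 ≤ N) (y y' : Site (d + 1)) :
    ∀ (κ : Fin (d + 1)) (x : Site (d + 1)), gaugeWt N y κ x ≠ 0 →
      (N : ℝ) * l1 (y - y') - (((d : ℝ) + 1) * N + 1) ≤ l1 (x - (N : ℤ) • y') := by
  intro κ x h
  have h1 := l1_sub_le_of_gaugeWt_ne_zero hN h
  have h2 : l1 ((N : ℤ) • y - (N : ℤ) • y') ≤ l1 ((N : ℤ) • y - x) + l1 (x - (N : ℤ) • y') := l1_sub_triangle _ _ _
  have h3 : l1 ((N : ℤ) • y - (N : ℤ) • y') = (N : ℝ) * l1 (y - y') := by rw [← smul_sub, l1_natSmul]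
  linarith

/-! ## §2 The read weights of a kernel sitting at the slot `N•y′` against the label-`y` gauge weight decay in `N·|y − y′|₁` -/

/-- [folklore] **READ WEIGHTS DECAY OFF THE LABEL**: for `A′` bi-localised at `(p, N•y′)` (rate `δ > 0`), the read weight against `gaugeWt N y`,
`|Σ'_{x₂} Σ_κ₂ A′ u x₂ a (inl κ₂)·gaugeWt N y κ₂ x₂| ≤ K₁·e^{−(δ/2)·N·|y − y′|₁}·e^{−δ|u − p|₁}`, `K₁ = (d+1)·C·Zl(δ/2)·e^{(δ/2)((d+1)N+1)}`
(`GaugeReadLabelSums.abs_read_le_of_support` with the witness of §1). -/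
theorem abs_read_gaugeWt_le {N : ℕ} (hN : 1 ≤ N) {A' : MKer (d + 1) (Fib d)} {p : Site (d + 1)} {C δ : ℝ} {y y' : Site (d + 1)}
    (hA : BiLoc A' p ((N : ℤ) • y') C δ) (hδ : 0 < δ) (u : Site (d + 1)) (a : Fib d) :
    |∑' x₂, ∑ κ₂, A' u x₂ a (Sum.inl κ₂) * gaugeWt N y κ₂ x₂| ≤
      ((d + 1 : ℕ) * C * Zl (d + 1) (δ / 2) * Real.exp ((δ / 2) * (((d : ℝ) + 1) * N + 1))) *
        Real.exp (-(δ / 2) * ((N : ℝ) * l1 (y - y'))) * Real.exp (-δ * l1 (u - p)) := by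
  have h := abs_read_le_of_support hA hδ (fun κ x => abs_gaugeWt_le_one N y κ x) (dist_le_of_gaugeWt_ne_zero hN y y') u a
  refine h.trans (le_of_eq ?_)
  rw [show -(δ / 2) * ((N : ℝ) * l1 (y - y') - (((d : ℝ) + 1) * N + 1))
      = (δ / 2) * (((d : ℝ) + 1) * N + 1) + -(δ / 2) * ((N : ℝ) * l1 (y - y')) by ring, Real.exp_add]
  ring

/-! ## §3 Pair charges of bi-localised kernels are bounded -/

/-- [folklore] `|Σ'_{(x,z)} K x z a b| ≤ C·Zl(δ)²` for `K` bi-localised with constant `C`, rate `δ > 0`. -/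
theorem abs_tsum_prod_le_of_biLoc {K : MKer (d + 1) (Fib d)} {p q : Site (d + 1)} {C δ : ℝ} (hK : BiLoc K p q C δ) (hδ : 0 < δ)
    (a b : Fib d) : |∑' xz : Site (d + 1) × Site (d + 1), K xz.1 xz.2 a b| ≤ C * (Zl (d + 1) δ * Zl (d + 1) δ) := by
  have hs := summable_prod_of_biLoc hK hδ a b
  have h1 : HasSum (fun x : Site (d + 1) => Real.exp (-δ * l1 (x - p))) (Zl (d + 1) δ) := by
    rw [← tsum_exp_shift' p]; exact (summable_exp_shift' hδ p).hasSum
  have h2 : HasSum (fun z : Site (d + 1) => Real.exp (-δ * l1 (z - q))) (Zl (d + 1) δ) := by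
    rw [← tsum_exp_shift' q]; exact (summable_exp_shift' hδ q).hasSum
  have hprod : HasSum (fun xz : Site (d + 1) × Site (d + 1) => Real.exp (-δ * l1 (xz.1 - p)) * Real.exp (-δ * l1 (xz.2 - q)))
      (Zl (d + 1) δ * Zl (d + 1) δ) :=
    h1.mul h2 (h1.summable.mul_of_nonneg h2.summable (fun _ => (Real.exp_pos _).le) (fun _ => (Real.exp_pos _).le))
  calc |∑' xz : Site (d + 1) × Site (d + 1), K xz.1 xz.2 a b| ≤ ∑' xz : Site (d + 1) × Site (d + 1), |K xz.1 xz.2 a b| := by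
        have h := norm_tsum_le_tsum_norm hs.norm
        simpa only [Real.norm_eq_abs] using h
    _ ≤ ∑' xz : Site (d + 1) × Site (d + 1), C * (Real.exp (-δ * l1 (xz.1 - p)) * Real.exp (-δ * l1 (xz.2 - q))) :=
        Summable.tsum_le_tsum (fun xz => by
          have h := hK xz.1 xz.2 a b
          rwa [mul_add, Real.exp_add] at h) hs.abs (hprod.summable.mul_left C)
    _ = C * (Zl (d + 1) δ * Zl (d + 1) δ) := by rw [tsum_mul_left, hprod.tsum_eq]

/-! ## §4 The first slot-moment family is absolutely summable on (slot, stencil index) -/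

/-- [folklore] The linear slot weight against the coarse Gaussian: `|(y′ − y)_λ|·e^{−(δ/2)·N·|y − y′|₁} ≤ (4/δ)·e^{−(δ/4)|y′ − y|₁}` (`N ≥ 1`, `δ > 0`). -/
theorem abs_coord_mul_exp_le {N : ℕ} (hN : 1 ≤ N) {δ : ℝ} (hδ : 0 < δ) (y y' : Site (d + 1)) (lam : Fin (d + 1)) :
    |(((y' - y) lam : ℤ) : ℝ)| * Real.exp (-(δ / 2) * ((N : ℝ) * l1 (y - y'))) ≤ 4 / δ * Real.exp (-(δ / 4) * l1 (y' - y)) := by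
  have hl : |(((y' - y) lam : ℤ) : ℝ)| ≤ l1 (y' - y) := abs_apply_le_l1 (y' - y) lam
  have hsymm : l1 (y - y') = l1 (y' - y) := l1_sub_symm y y'
  have hN' : (1 : ℝ) ≤ N := by exact_mod_cast hN
  have h0 : 0 ≤ l1 (y' - y) := l1_nonneg _
  have h1 : Real.exp (-(δ / 2) * ((N : ℝ) * l1 (y - y'))) ≤ Real.exp (-(δ / 2) * l1 (y' - y)) := by
    rw [Real.exp_le_exp, hsymm]
    have h3 : l1 (y' - y) ≤ (N : ℝ) * l1 (y' - y) := le_mul_of_one_le_left h0 hN'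
    have h4 := mul_le_mul_of_nonneg_left h3 (half_pos hδ).le
    linarith
  have h2 := mul_exp_neg_le (half_pos hδ) (l1 (y' - y))
  have e : 2 / (δ / 2) * Real.exp (-(δ / 2 / 2) * l1 (y' - y)) = 4 / δ * Real.exp (-(δ / 4) * l1 (y' - y)) := by
    rw [show δ / 2 / 2 = δ / 4 by ring]
    congr 1
    field_simp
    ring
  calc |(((y' - y) lam : ℤ) : ℝ)| * Real.exp (-(δ / 2) * ((N : ℝ) * l1 (y - y')))
      ≤ l1 (y' - y) * Real.exp (-(δ / 2) * l1 (y' - y)) := mul_le_mul hl h1 (Real.exp_pos _).le h0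
    _ ≤ 4 / δ * Real.exp (-(δ / 4) * l1 (y' - y)) := by rw [← e]; exact h2

/-- [folklore] A SHIFTED PRODUCT MAJORANT IS SUMMABLE: `(y′, u) ↦ Φ·e^{−c|y′ − y|₁}·e^{−δ|u − s y′|₁}` is summable on `Site × Site` for `c, δ > 0` and ANY
centre map `s` (fibrewise `Zl δ`, then the coarse Gaussian). -/
theorem summable_shifted_majorant {c δ : ℝ} (hc : 0 < c) (hδ : 0 < δ) (Φ : ℝ) (y : Site (d + 1)) (s : Site (d + 1) → Site (d + 1)) :
    Summable fun yu : Site (d + 1) × Site (d + 1) => Φ * (Real.exp (-c * l1 (yu.1 - y)) * Real.exp (-δ * l1 (yu.2 - s yu.1))) := by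
  set g : Site (d + 1) × Site (d + 1) → ℝ := fun yu => Real.exp (-c * l1 (yu.1 - y)) * Real.exp (-δ * l1 (yu.2 - s yu.1)) with hg
  have hg0 : 0 ≤ g := fun yu => by positivity
  have hinner : ∀ y' : Site (d + 1), HasSum (fun u : Site (d + 1) => g (y', u)) (Real.exp (-c * l1 (y' - y)) * Zl (d + 1) δ) := by
    intro y'
    have hu : HasSum (fun u : Site (d + 1) => Real.exp (-δ * l1 (u - s y'))) (Zl (d + 1) δ) := by
      rw [← tsum_exp_shift' (s y')]
      exact (summable_exp_shift' hδ _).hasSum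
    exact hu.mul_left _
  have hgs : Summable g := by
    refine (summable_prod_of_nonneg hg0).2 ⟨fun y' => (hinner y').summable, ?_⟩
    have e : (fun y' : Site (d + 1) => ∑' u : Site (d + 1), g (y', u)) = fun y' => Zl (d + 1) δ * Real.exp (-c * l1 (y' - y)) := by
      funext y'
      rw [(hinner y').tsum_eq, mul_comm]
    rw [e]
    exact (summable_exp_shift' hc y).mul_left _
  exact hgs.mul_left Φ

/-- [folklore] **THE FINE MOMENT FAMILY IS ABSOLUTELY SUMMABLE**: for a slot-indexed family `A′ y′` bi-localised at `(N•y′, N•y′)` (one constant `C`, rate `δ > 0`),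
a localised stencil table `S` (`LocStencil S Cs δ`) and `1 ≤ N`, the family
`(y′, u) ↦ (y′ − y)_λ · (Σ'Σ A′ y′ u x₂ a (inl κ₂)·gaugeWt N y κ₂ x₂) · Z(S κ u)` is summable on `Site × Site`. -/
theorem summable_moment_fine {N : ℕ} (hN : 1 ≤ N) {A' : Site (d + 1) → MKer (d + 1) (Fib d)} {C δ : ℝ}
    (hA : ∀ y', BiLoc (A' y') ((N : ℤ) • y') ((N : ℤ) • y') C δ) (hδ : 0 < δ)
    {S : Fin (d + 1) → Site (d + 1) → MKer (d + 1) (Fib d)} {Cs : ℝ} (hS : LocStencil S Cs δ)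
    (y : Site (d + 1)) (lam κ : Fin (d + 1)) (a a' b' : Fib d) :
    Summable fun yu : Site (d + 1) × Site (d + 1) => (((yu.1 - y) lam : ℤ) : ℝ) *
      ((∑' x₂, ∑ κ₂, A' yu.1 yu.2 x₂ a (Sum.inl κ₂) * gaugeWt N y κ₂ x₂) * ∑' xz : Site (d + 1) × Site (d + 1), S κ yu.2 xz.1 xz.2 a' b') := by
  set K₁ : ℝ := (d + 1 : ℕ) * C * Zl (d + 1) (δ / 2) * Real.exp ((δ / 2) * (((d : ℝ) + 1) * N + 1)) with hK₁
  have hmaj := summable_shifted_majorant (d := d) (c := δ / 4) (by positivity) hδ (4 / δ * K₁ * (Cs * (Zl (d + 1) δ * Zl (d + 1) δ))) y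
    (fun y' => (N : ℤ) • y')
  refine Summable.of_norm_bounded hmaj (fun yu => ?_)
  rw [Real.norm_eq_abs, abs_mul, abs_mul]
  have hw := abs_read_gaugeWt_le hN (y := y) (hA yu.1) hδ yu.2 a
  have hZ := abs_tsum_prod_le_of_biLoc (hS κ yu.2) hδ a' b'
  have hc := abs_coord_mul_exp_le hN hδ y yu.1 lam
  have hK0 : 0 ≤ K₁ := by
    have hC : 0 ≤ C := (hA yu.1).nonneg a
    rw [hK₁]; have := Zl_nonneg (D := d + 1) (half_pos hδ); positivity
  have hZ0 : 0 ≤ Cs * (Zl (d + 1) δ * Zl (d + 1) δ) := (abs_nonneg _).trans hZ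
  calc |(((yu.1 - y) lam : ℤ) : ℝ)| * (|∑' x₂, ∑ κ₂, A' yu.1 yu.2 x₂ a (Sum.inl κ₂) * gaugeWt N y κ₂ x₂| *
          |∑' xz : Site (d + 1) × Site (d + 1), S κ yu.2 xz.1 xz.2 a' b'|)
      ≤ |(((yu.1 - y) lam : ℤ) : ℝ)| * ((K₁ * Real.exp (-(δ / 2) * ((N : ℝ) * l1 (y - yu.1))) * Real.exp (-δ * l1 (yu.2 - (N : ℤ) • yu.1))) *
          (Cs * (Zl (d + 1) δ * Zl (d + 1) δ))) :=
        mul_le_mul_of_nonneg_left (mul_le_mul hw hZ (abs_nonneg _) ((abs_nonneg _).trans hw)) (abs_nonneg _)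
    _ = (|(((yu.1 - y) lam : ℤ) : ℝ)| * Real.exp (-(δ / 2) * ((N : ℝ) * l1 (y - yu.1)))) *
          (K₁ * (Cs * (Zl (d + 1) δ * Zl (d + 1) δ))) * Real.exp (-δ * l1 (yu.2 - (N : ℤ) • yu.1)) := by ring
    _ ≤ (4 / δ * Real.exp (-(δ / 4) * l1 (yu.1 - y))) * (K₁ * (Cs * (Zl (d + 1) δ * Zl (d + 1) δ))) * Real.exp (-δ * l1 (yu.2 - (N : ℤ) • yu.1)) :=
        mul_le_mul_of_nonneg_right (mul_le_mul_of_nonneg_right hc (mul_nonneg hK0 hZ0)) (Real.exp_pos _).le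
    _ = 4 / δ * K₁ * (Cs * (Zl (d + 1) δ * Zl (d + 1) δ)) * (Real.exp (-(δ / 4) * l1 (yu.1 - y)) * Real.exp (-δ * l1 (yu.2 - (N : ℤ) • yu.1))) := by
        ring

/-- [folklore] **THE COARSE MOMENT FAMILY IS ABSOLUTELY SUMMABLE**: same with the coarse read weights `w ↦ Σ'Σ A′ y′ (N•w) x₂ a (inl κ₂)·gaugeWt N y κ₂ x₂` and a
vertex table `M` (`VertexFamily M N CM δ`). -/
theorem summable_moment_coarse {N : ℕ} (hN : 1 ≤ N) {A' : Site (d + 1) → MKer (d + 1) (Fib d)} {C δ : ℝ}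
    (hA : ∀ y', BiLoc (A' y') ((N : ℤ) • y') ((N : ℤ) • y') C δ) (hδ : 0 < δ)
    {M : Fin (d + 1) → Site (d + 1) → MKer (d + 1) (Fib d)} {CM : ℝ} (hM : VertexFamily M N CM δ)
    (y : Site (d + 1)) (lam ρ : Fin (d + 1)) (a a' b' : Fib d) :
    Summable fun yw : Site (d + 1) × Site (d + 1) => (((yw.1 - y) lam : ℤ) : ℝ) *
      ((∑' x₂, ∑ κ₂, A' yw.1 ((N : ℤ) • yw.2) x₂ a (Sum.inl κ₂) * gaugeWt N y κ₂ x₂) *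
        ∑' xz : Site (d + 1) × Site (d + 1), M ρ yw.2 xz.1 xz.2 a' b') := by
  set K₁ : ℝ := (d + 1 : ℕ) * C * Zl (d + 1) (δ / 2) * Real.exp ((δ / 2) * (((d : ℝ) + 1) * N + 1)) with hK₁
  have hmaj := summable_shifted_majorant (d := d) (c := δ / 4) (by positivity) hδ (4 / δ * K₁ * (CM * (Zl (d + 1) δ * Zl (d + 1) δ))) y
    (fun y' => y')
  refine Summable.of_norm_bounded hmaj (fun yw => ?_)
  rw [Real.norm_eq_abs, abs_mul, abs_mul]
  have hw := abs_read_gaugeWt_le hN (y := y) (hA yw.1) hδ ((N : ℤ) • yw.2) a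
  have hZ := abs_tsum_prod_le_of_biLoc (hM ρ yw.2) hδ a' b'
  have hc := abs_coord_mul_exp_le hN hδ y yw.1 lam
  have hK0 : 0 ≤ K₁ := by
    have hC : 0 ≤ C := (hA yw.1).nonneg a
    rw [hK₁]; have := Zl_nonneg (D := d + 1) (half_pos hδ); positivity
  have hZ0 : 0 ≤ CM * (Zl (d + 1) δ * Zl (d + 1) δ) := (abs_nonneg _).trans hZ
  -- the coarse Gaussian dominates the fine one: `|N•w − N•y′|₁ = N|w − y′|₁ ≥ |w − y′|₁`
  have hexp : Real.exp (-δ * l1 ((N : ℤ) • yw.2 - (N : ℤ) • yw.1)) ≤ Real.exp (-δ * l1 (yw.2 - yw.1)) := by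
    rw [Real.exp_le_exp, ← smul_sub, l1_natSmul]
    have hN' : (1 : ℝ) ≤ N := by exact_mod_cast hN
    have h0 : 0 ≤ l1 (yw.2 - yw.1) := l1_nonneg _
    have h3 : l1 (yw.2 - yw.1) ≤ (N : ℝ) * l1 (yw.2 - yw.1) := le_mul_of_one_le_left h0 hN'
    have h4 := mul_le_mul_of_nonneg_left h3 hδ.le
    linarith
  calc |(((yw.1 - y) lam : ℤ) : ℝ)| * (|∑' x₂, ∑ κ₂, A' yw.1 ((N : ℤ) • yw.2) x₂ a (Sum.inl κ₂) * gaugeWt N y κ₂ x₂| *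
          |∑' xz : Site (d + 1) × Site (d + 1), M ρ yw.2 xz.1 xz.2 a' b'|)
      ≤ |(((yw.1 - y) lam : ℤ) : ℝ)| * ((K₁ * Real.exp (-(δ / 2) * ((N : ℝ) * l1 (y - yw.1))) * Real.exp (-δ * l1 ((N : ℤ) • yw.2 - (N : ℤ) • yw.1))) *
          (CM * (Zl (d + 1) δ * Zl (d + 1) δ))) :=
        mul_le_mul_of_nonneg_left (mul_le_mul hw hZ (abs_nonneg _) ((abs_nonneg _).trans hw)) (abs_nonneg _)
    _ = (|(((yw.1 - y) lam : ℤ) : ℝ)| * Real.exp (-(δ / 2) * ((N : ℝ) * l1 (y - yw.1)))) *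
          (K₁ * (CM * (Zl (d + 1) δ * Zl (d + 1) δ))) * Real.exp (-δ * l1 ((N : ℤ) • yw.2 - (N : ℤ) • yw.1)) := by ring
    _ ≤ (4 / δ * Real.exp (-(δ / 4) * l1 (yw.1 - y))) * (K₁ * (CM * (Zl (d + 1) δ * Zl (d + 1) δ))) * Real.exp (-δ * l1 (yw.2 - yw.1)) :=
        mul_le_mul (mul_le_mul_of_nonneg_right hc (mul_nonneg hK0 hZ0)) hexp (Real.exp_pos _).le
          (mul_nonneg (by positivity) (mul_nonneg hK0 hZ0))
    _ = 4 / δ * K₁ * (CM * (Zl (d + 1) δ * Zl (d + 1) δ)) * (Real.exp (-(δ / 4) * l1 (yw.1 - y)) * Real.exp (-δ * l1 (yw.2 - yw.1))) := by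
        ring

/-! ## §5 THE FIRST SLOT-MOMENT OF THE (γ) CHARGE IN CLOSED FORM -/

/-- **THE (γ) SLOT-DIPOLE IN CLOSED FORM** ([folklore] Fubini on the families of §4).  Setting: `1 ≤ N`; the response kernels `A ν y′` of the
multiplier slots `(ν, y′)` form a `VertexFamily A N CA δ` (bi-localised at `N•y′`; in the literal `A ν y′ = G_j ∘ dM G_j Lc S_j M_j ν y′`); `S` a localised stencil
table, `M` a vertex table (rate `δ > 0`); label `y`.  The (γ) CHARGE AT THE SLOT `(ν, y′)` is the value of `GaugeReadCharge.hasSum_prod_gaugeSup` for `A ν y′` read against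
`gaugeWt N y`: `Q(y′) = Σ_κ Σ'_u w_κ(y′,u)·Z(S κ u) + Σ_ρ Σ'_w w′_ρ(y′,w)·Z(M ρ w)`, `w_κ(y′,u) = Σ'_{x₂} Σ_κ₂ A ν y′ u x₂ (inl κ)(inl κ₂)·gaugeWt N y κ₂ x₂`,
`w′_ρ(y′,w) =` the same at `u = N•w`, row `inr ρ`, `Z(K) = Σ'_{(x,z)} K x z a b`.  Then its FIRST SLOT-MOMENT about the label converges and
`Σ'_{y′} (y′ − y)_λ·Q(y′) = Σ_κ Σ'_u (Σ'_{y′} (y′ − y)_λ·w_κ(y′,u))·Z(S κ u) + Σ_ρ Σ'_w (Σ'_{y′} (y′ − y)_λ·w′_ρ(y′,w))·Z(M ρ w)` — the letters' pair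
charges weighted by the FIRST SLOT-MOMENTS OF THE READ WEIGHTS (the (γ) side of the OWNER gan24-p1 g26's W15 «both closed forms side by side»; the (α) side is
road-P2's `WardResidualRotatedVertexDipole`).  Asserts NO value of any `Z`, NO cancellation. -/
theorem hasSum_slotMoment_gaugeCharge {N : ℕ} (hN : 1 ≤ N) {A : Fin (d + 1) → Site (d + 1) → MKer (d + 1) (Fib d)} {CA δ : ℝ}
    (hA : VertexFamily A N CA δ) (hδ : 0 < δ)
    {S : Fin (d + 1) → Site (d + 1) → MKer (d + 1) (Fib d)} {Cs : ℝ} (hS : LocStencil S Cs δ)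
    {M : Fin (d + 1) → Site (d + 1) → MKer (d + 1) (Fib d)} {CM : ℝ} (hM : VertexFamily M N CM δ)
    (y : Site (d + 1)) (ν lam : Fin (d + 1)) (a b : Fib d) :
    HasSum (fun y' : Site (d + 1) => (((y' - y) lam : ℤ) : ℝ) *
        (∑ κ, ∑' u, (∑' x₂, ∑ κ₂, A ν y' u x₂ (Sum.inl κ) (Sum.inl κ₂) * gaugeWt N y κ₂ x₂) *
              ∑' xz : Site (d + 1) × Site (d + 1), S κ u xz.1 xz.2 a b
          + ∑ ρ, ∑' w, (∑' x₂, ∑ κ₂, A ν y' ((N : ℤ) • w) x₂ (Sum.inr ρ) (Sum.inl κ₂) * gaugeWt N y κ₂ x₂) *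
              ∑' xz : Site (d + 1) × Site (d + 1), M ρ w xz.1 xz.2 a b))
      (∑ κ, ∑' u, (∑' y' : Site (d + 1), (((y' - y) lam : ℤ) : ℝ) * ∑' x₂, ∑ κ₂, A ν y' u x₂ (Sum.inl κ) (Sum.inl κ₂) * gaugeWt N y κ₂ x₂) *
            ∑' xz : Site (d + 1) × Site (d + 1), S κ u xz.1 xz.2 a b
        + ∑ ρ, ∑' w, (∑' y' : Site (d + 1), (((y' - y) lam : ℤ) : ℝ) * ∑' x₂, ∑ κ₂, A ν y' ((N : ℤ) • w) x₂ (Sum.inr ρ) (Sum.inl κ₂) * gaugeWt N y κ₂ x₂) *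
            ∑' xz : Site (d + 1) × Site (d + 1), M ρ w xz.1 xz.2 a b) := by
  -- the two moment families, slot first
  set fF : Fin (d + 1) → Site (d + 1) → Site (d + 1) → ℝ := fun κ y' u => (((y' - y) lam : ℤ) : ℝ) *
    ((∑' x₂, ∑ κ₂, A ν y' u x₂ (Sum.inl κ) (Sum.inl κ₂) * gaugeWt N y κ₂ x₂) * ∑' xz : Site (d + 1) × Site (d + 1), S κ u xz.1 xz.2 a b) with hfF
  set fC : Fin (d + 1) → Site (d + 1) → Site (d + 1) → ℝ := fun ρ y' w => (((y' - y) lam : ℤ) : ℝ) *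
    ((∑' x₂, ∑ κ₂, A ν y' ((N : ℤ) • w) x₂ (Sum.inr ρ) (Sum.inl κ₂) * gaugeWt N y κ₂ x₂) *
      ∑' xz : Site (d + 1) × Site (d + 1), M ρ w xz.1 xz.2 a b) with hfC
  have hsF : ∀ κ, Summable (Function.uncurry (fF κ)) := fun κ =>
    summable_moment_fine hN (A' := A ν) (fun y' => hA ν y') hδ hS y lam κ (Sum.inl κ) a b
  have hsC : ∀ ρ, Summable (Function.uncurry (fC ρ)) := fun ρ =>
    summable_moment_coarse hN (A' := A ν) (fun y' => hA ν y') hδ hM y lam ρ (Sum.inr ρ) a b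
  -- fine part, one `κ` at a time: sum over the slot first, then exchange
  have hF : ∀ κ, HasSum (fun y' => ∑' u, fF κ y' u)
      (∑' u, (∑' y' : Site (d + 1), (((y' - y) lam : ℤ) : ℝ) * ∑' x₂, ∑ κ₂, A ν y' u x₂ (Sum.inl κ) (Sum.inl κ₂) * gaugeWt N y κ₂ x₂) *
        ∑' xz : Site (d + 1) × Site (d + 1), S κ u xz.1 xz.2 a b) := by
    intro κ
    have h1 : HasSum (fun y' => ∑' u, fF κ y' u) (∑' y', ∑' u, fF κ y' u) := (hsF κ).prod.hasSum
    have hcomm : ∑' u, ∑' y', fF κ y' u = ∑' y', ∑' u, fF κ y' u := (hsF κ).tsum_comm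
    have hv : ∑' y', ∑' u, fF κ y' u = ∑' u, (∑' y' : Site (d + 1), (((y' - y) lam : ℤ) : ℝ) *
        ∑' x₂, ∑ κ₂, A ν y' u x₂ (Sum.inl κ) (Sum.inl κ₂) * gaugeWt N y κ₂ x₂) * ∑' xz : Site (d + 1) × Site (d + 1), S κ u xz.1 xz.2 a b := by
      rw [← hcomm]
      refine tsum_congr fun u => ?_
      rw [← tsum_mul_right]
      exact tsum_congr fun y' => by rw [hfF]; ring
    rw [hv] at h1
    exact h1
  -- coarse part, one `ρ` at a time
  have hC : ∀ ρ, HasSum (fun y' => ∑' w, fC ρ y' w)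
      (∑' w, (∑' y' : Site (d + 1), (((y' - y) lam : ℤ) : ℝ) * ∑' x₂, ∑ κ₂, A ν y' ((N : ℤ) • w) x₂ (Sum.inr ρ) (Sum.inl κ₂) * gaugeWt N y κ₂ x₂) *
        ∑' xz : Site (d + 1) × Site (d + 1), M ρ w xz.1 xz.2 a b) := by
    intro ρ
    have h1 : HasSum (fun y' => ∑' w, fC ρ y' w) (∑' y', ∑' w, fC ρ y' w) := (hsC ρ).prod.hasSum
    have hcomm : ∑' w, ∑' y', fC ρ y' w = ∑' y', ∑' w, fC ρ y' w := (hsC ρ).tsum_comm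
    have hv : ∑' y', ∑' w, fC ρ y' w = ∑' w, (∑' y' : Site (d + 1), (((y' - y) lam : ℤ) : ℝ) *
        ∑' x₂, ∑ κ₂, A ν y' ((N : ℤ) • w) x₂ (Sum.inr ρ) (Sum.inl κ₂) * gaugeWt N y κ₂ x₂) *
          ∑' xz : Site (d + 1) × Site (d + 1), M ρ w xz.1 xz.2 a b := by
      rw [← hcomm]
      refine tsum_congr fun w => ?_
      rw [← tsum_mul_right]
      exact tsum_congr fun y' => by rw [hfC]; ring
    rw [hv] at h1
    exact h1
  have hsum := (hasSum_sum fun κ (_ : κ ∈ (Finset.univ : Finset (Fin (d + 1)))) => hF κ).add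
    (hasSum_sum fun ρ (_ : ρ ∈ (Finset.univ : Finset (Fin (d + 1)))) => hC ρ)
  refine hsum.congr_fun fun y' => ?_
  rw [mul_add, Finset.mul_sum, Finset.mul_sum]
  congr 1
  · exact Finset.sum_congr rfl fun κ _ => by rw [hfF, ← tsum_mul_left]
  · exact Finset.sum_congr rfl fun ρ _ => by rw [hfC, ← tsum_mul_left]

end Summit.QuantumFields.BalabanUV.Beta.GAN24.GaugeReadChargeDipole

end
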